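import Literature.GroupTheory.FiniteActionProfiniteCompletion
import Literature.AnabelianGeometry.Anabelioids.BCatFundamentalGroup
import Mathlib.CategoryTheory.Galois.Topology
import Mathlib.Topology.Algebra.ContinuousMonoidHom
import Literature.IUT.HodgeTheaters.DiscreteProfiniteConjugates
import HarnessLib

/-!
# `π₁` of the Galois category of finite `G`-sets at the forgetful basepoint is the profinite completion `Ĝ`

PROOF-ONLY companion (abc-iut cell, campaign-L R1, GAP row G-L4t14-R1 support; seat abc-iut-f-072).
[GeoAn] §1.1 p. 9: for PROFINITE `G`, «`G` may be recovered … from `(B(G), β)` as `Aut(β_*)`» — in the tree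
`exists_continuousMulEquiv_aut_forget` (`BCatFundamentalGroup.lean`).  For a DISCRETE group `G` the Galois
category is Mathlib's `Action FintypeCat G` of finite `G`-sets, and its fundamental group at the forgetful
basepoint is the PROFINITE COMPLETION: transporting along abc-iut-w5-d144's
`FiniteActionCompletion.equivalence G : Action FintypeCat G ≌ B(Ĝ)` (whose functor followed by the forgetful
functor of `B(Ĝ)` IS the forgetful functor of `Action FintypeCat G`, definitionally) — whiskering
`σ ↦ e.functor ◁ σ` is an isomorphism of topological groups `Aut F ≃ₜ* Aut (e.functor ⋙ F)` for any
equivalence `e` (Mathlib `Equivalence.congrLeft`, `autMulEquivOfFullyFaithful`, continuity through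
`PreGaloisCategory.autEmbedding`; packaged reusably in `Anabelioids/BasepointTransport.lean`, inlined here):

* `exists_continuousMulEquiv_aut_forget_action G : ∃ e : Ĝ ≃ₜ* Aut (Action.forget FintypeCat G),
  ∀ g A, (e (η g))_A = ρ_A(g)` — an isomorphism of topological groups under which `η(g)` acts on every
  finite `G`-set `A` by `g` (this determines `e`, `η(G)` being dense).

([SemiAnbd] Prop. 3.6 (iii) p. 38 is the tempered analogue: the finite objects of `B^temp(Π)` see exactly `Π̂`.)
No definition, no named fact; nothing here bears on [IUTchIII] Cor. 3.12.
-/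

noncomputable section

open CategoryTheory CategoryTheory.PreGaloisCategory
open scoped FintypeCatDiscrete

universe u

namespace Literature.AnabelianGeometry.Anabelioids

open Literature.GroupTheory Literature.GroupTheory.FiniteActionCompletion Literature.IUT.HodgeTheaters
open Literature.AlgebraicGeometry.Frobenioids (BCat)

/-- The functor of `FiniteActionCompletion.equivalence G` followed by the forgetful functor of `B(Ĝ)` IS the
forgetful functor of `Action FintypeCat G` (definitionally: the extension does not change carriers or maps).
[cite: MochizukiGeoAn2004, §1.1 p.9] -/
theorem equivalence_functor_comp_forget (G : Type u) [Group G] :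
    (FiniteActionCompletion.equivalence G).functor ⋙
        (ObjectProperty.ι (Action.IsContinuous (V := FintypeCat.{u}) (G := Ghat G)) ⋙
          Action.forget FintypeCat.{u} (Ghat G)) =
      Action.forget FintypeCat.{u} G := rfl

/-- **`π₁({finite G-sets}, forget) = Ĝ`**: for every group `G` there is an isomorphism of topological
groups `e : Ĝ ≃ₜ* Aut (Action.forget FintypeCat G)` from the profinite completion onto the automorphism
group of the forgetful fibre functor of Mathlib's Galois category of finite `G`-sets, under which `η(g)`
acts on each finite `G`-set `A` as `ρ_A(g)`. [cite: MochizukiGeoAn2004, §1.1 p.9] -/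
theorem exists_continuousMulEquiv_aut_forget_action (G : Type u) [Group G] :
    ∃ e : profiniteCompletion G ≃ₜ* Aut (Action.forget FintypeCat.{u} G),
      ∀ (g : G) (A : Action FintypeCat.{u} G), (e (toCompletion G g)).hom.app A = A.ρ g := by
  obtain ⟨e₁, he₁⟩ :=
    exists_continuousMulEquiv_aut_forget.{u} (G := profiniteCompletion G)
  -- transport of the basepoint along the equivalence `Action FintypeCat G ≌ B(Ĝ)`
  let eqv := FiniteActionCompletion.equivalence G
  let F := ObjectProperty.ι (Action.IsContinuous (V := FintypeCat.{u}) (G := Ghat G)) ⋙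
    Action.forget FintypeCat.{u} (Ghat G)
  let φ : Aut F ≃* Aut (eqv.functor ⋙ F) :=
    (eqv.symm.congrLeft (E := FintypeCat.{u})).fullyFaithfulFunctor.autMulEquivOfFullyFaithful F
  have hφ : ∀ (σ : Aut F) (A : Action FintypeCat.{u} G), (φ σ).hom.app A = σ.hom.app (eqv.functor.obj A) :=
    fun _ _ => rfl
  have hφc : Continuous φ := by
    rw [(autEmbedding_isClosedEmbedding _).isInducing.continuous_iff, continuous_pi_iff]
    intro A
    change Continuous fun a ↦ autEmbedding F a (eqv.functor.obj A)
    fun_prop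
  let e₂ : Aut F ≃ₜ* Aut (eqv.functor ⋙ F) :=
    { φ with
      continuous_toFun := hφc
      continuous_invFun := Continuous.continuous_symm_of_equiv_compact_to_t2 (f := φ.toEquiv) hφc }
  refine ⟨e₁.trans e₂, fun g A => ?_⟩
  change (φ (e₁ (toCompletion G g))).hom.app A = A.ρ g
  rw [hφ, he₁]
  ext a
  exact restrict_extendObj_ρ G A g a

end Literature.AnabelianGeometry.Anabelioids
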